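import Literature.NumberTheory.CubicFields.UniformitySubringSum
import Mathlib.Analysis.PSeries
import Mathlib.Analysis.SpecialFunctions.Exp
import HarnessLib

/-!
# The Euler product over primes: `Σ_{n ≤ N} e(n)/n² ≤ e¹⁹` for the uniform subring-count bound

`Proofs`-style file (theorems only: no definitions, no named facts). Topic
`Literature/NumberTheory/CubicFields`; continues `UniformitySubringSum.lean` (`a_g(n) ≤ e(n) = ∏_{pⁱ ∥ n} ē_p(i)`
for every maximal nondegenerate cubic ring `R(g)`, and the partial-sum bounds
`Σ_{i<I} ē_p(i) xⁱ ≤ ((1 − x²)(1 − θ))⁻¹`, `θ = 3x + (p+1)x³`).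

This is the second half of the elementary replacement for the Datskovsky–Wright input of the published
proof of Belabas–Bhargava–Pomerance 2010, Lemma 3.4 = Bhargava–Taniguchi–Thorne 2023, Prop. 4.5
(Taniguchi–Thorne 2013, proof of Lemma 14: "the sum over `j` converges"):

* `inv_sq_bounds`, `ebound_le` — at `x = p⁻²` (`p ≥ 2`): `θ_p ≤ 51/64 < 1` and
  `E_p := ((1 − p⁻⁴)(1 − θ_p))⁻¹ ≤ 1 + 19/p²`;
* `prod_le_exp_of_le` — `∏_{p ∈ P} (1 + 19/p²) ≤ e¹⁹` over any finite set of primes;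
* `sum_filter_insert_le`, `sum_filter_le_prod`, `sum_Icc_le_of_prod_le` — peeling one prime at a time,
  **`Σ_{n ≤ N, primes(n) ⊆ P} e(n)/n² ≤ ∏_{p ∈ P} E_p`** for any `e` with `e(pⁱm) = ē_p(i) e(m)` (`p ∤ m`);
* `exists_recursion_seqs` — the hypothesised recursion sequences exist;
* **`exists_uniform_indexPOrbits_bound`** — the packaged statement used downstream: there are `e : ℕ → ℕ`
  and `K₀` (`= e¹⁹`) with `#indexPOrbits g n ≤ e(n)` for every maximal nondegenerate `g`, `n ≥ 1`, and
  `Σ_{n=1}^{N} e(n)/n² ≤ K₀` for all `N`.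

## References

* K. Belabas, M. Bhargava, C. Pomerance, *Error estimates for the Davenport–Heilbronn theorems*,
  Duke Math. J. 153 (2010) 173–210, Remark 2.5, Lemma 3.4 [BelabasBhargavaPomerance2010].
* T. Taniguchi, F. Thorne, *Secondary terms in counting functions for cubic fields*, Duke Math. J.
  162 (2013), proof of Lemma 14 [TaniguchiThorne2013].
* M. Bhargava, T. Taniguchi, F. Thorne, *Improved error estimates for the Davenport–Heilbronn
  theorems*, Math. Ann. 389 (2024) = arXiv:2107.12819, Prop. 4.5 [BhargavaTaniguchiThorne2023].
-/

noncomputable section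

namespace Literature.NumberTheory.CubicFields

open BinaryCubic RingOfForm Finset

section Numerics

variable (p : ℕ)

/-! ### Numerics at a prime: `θ_p ≤ 51/64`, `E_p ≤ 1 + 19/p²` -/

/-- For `p ≥ 2` and `x = p⁻²`: `0 ≤ x ≤ 1/4`, `(p+1)x³ ≤ 3/64`, `(p+1)x² ≤ 3/16`. [folklore] -/
theorem inv_sq_bounds (hp : 2 ≤ p) :
    (0 : ℝ) ≤ ((p : ℝ) ^ 2)⁻¹ ∧ ((p : ℝ) ^ 2)⁻¹ ≤ 1 / 4 ∧
      ((p : ℝ) + 1) * (((p : ℝ) ^ 2)⁻¹) ^ 3 ≤ 3 / 64 ∧ ((p : ℝ) + 1) * (((p : ℝ) ^ 2)⁻¹) ^ 2 ≤ 3 / 16 := by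
  have hp2 : (2 : ℝ) ≤ p := by exact_mod_cast hp
  have hp0 : (0 : ℝ) < p := by linarith
  have h4 : (4 : ℝ) ≤ (p : ℝ) ^ 2 := by nlinarith
  have h5 : (32 : ℝ) ≤ (p : ℝ) ^ 5 := by
    calc (32 : ℝ) = 2 ^ 5 := by norm_num
      _ ≤ (p : ℝ) ^ 5 := pow_le_pow_left₀ (by norm_num) hp2 5
  have h3 : (8 : ℝ) ≤ (p : ℝ) ^ 3 := by
    calc (8 : ℝ) = 2 ^ 3 := by norm_num
      _ ≤ (p : ℝ) ^ 3 := pow_le_pow_left₀ (by norm_num) hp2 3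
  refine ⟨by positivity, ?_, ?_, ?_⟩
  · rw [inv_eq_one_div]; exact one_div_le_one_div_of_le (by norm_num) h4
  · rw [inv_pow, ← pow_mul, show 2 * 3 = 6 by rfl, ← div_eq_mul_inv, div_le_div_iff₀ (by positivity) (by norm_num)]
    nlinarith
  · rw [inv_pow, ← pow_mul, show 2 * 2 = 4 by rfl, ← div_eq_mul_inv, div_le_div_iff₀ (by positivity) (by norm_num)]
    nlinarith

/-- **`E_p ≤ 1 + 19/p²`** for `p ≥ 2`, where `E_p = ((1 − x²)(1 − θ_p))⁻¹`, `x = p⁻²`, `θ_p = 3x + (p+1)x³`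
(indeed `θ_p ≤ 51/64`, `(1 − x²)(1 − θ_p) ≥ 195/1024` and `1 − (1 − x²)(1 − θ_p) ≤ (55/16)x`). [folklore] -/
theorem ebound_le (hp : 2 ≤ p) :
    3 * ((p : ℝ) ^ 2)⁻¹ + ((p : ℝ) + 1) * (((p : ℝ) ^ 2)⁻¹) ^ 3 < 1 ∧ (((p : ℝ) ^ 2)⁻¹) ^ 2 < 1 ∧
      ((1 - (((p : ℝ) ^ 2)⁻¹) ^ 2) * (1 - (3 * ((p : ℝ) ^ 2)⁻¹ + ((p : ℝ) + 1) * (((p : ℝ) ^ 2)⁻¹) ^ 3)))⁻¹ ≤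
        1 + 19 * ((p : ℝ) ^ 2)⁻¹ := by
  obtain ⟨hx0, hx4, hx3, hx2⟩ := inv_sq_bounds p hp
  set x : ℝ := ((p : ℝ) ^ 2)⁻¹
  have hθ : 3 * x + ((p : ℝ) + 1) * x ^ 3 ≤ 51 / 64 := by linarith
  have hxx : x ^ 2 ≤ 1 / 16 := by nlinarith
  refine ⟨by linarith, by linarith, ?_⟩
  set D : ℝ := (1 - x ^ 2) * (1 - (3 * x + ((p : ℝ) + 1) * x ^ 3)) with hD
  have hD1 : 195 / 1024 ≤ D := by
    rw [hD]
    have h1 : (15 : ℝ) / 16 ≤ 1 - x ^ 2 := by linarith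
    have h2 : (13 : ℝ) / 64 ≤ 1 - (3 * x + ((p : ℝ) + 1) * x ^ 3) := by linarith
    calc (195 : ℝ) / 1024 = 15 / 16 * (13 / 64) := by norm_num
      _ ≤ _ := mul_le_mul h1 h2 (by norm_num) (by linarith)
  have hD2 : 1 - D ≤ 55 / 16 * x := by
    have hx3' : ((p : ℝ) + 1) * x ^ 3 ≤ 3 / 16 * x := by
      have : ((p : ℝ) + 1) * x ^ 3 = ((p : ℝ) + 1) * x ^ 2 * x := by ring
      rw [this]; exact mul_le_mul_of_nonneg_right hx2 hx0
    have hxx' : x ^ 2 ≤ 1 / 4 * x := by nlinarith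
    have hθ0 : 0 ≤ 3 * x + ((p : ℝ) + 1) * x ^ 3 := by positivity
    rw [hD]; nlinarith
  have hDpos : 0 < D := by linarith
  rw [inv_eq_one_div, div_le_iff₀ hDpos]
  nlinarith

/-- **`∏_{p ∈ P} F p ≤ exp 19`** whenever `0 ≤ F p ≤ 1 + 19/p²` on a finite set `P` of primes
(`1 + u ≤ eᵘ` and `Σ_p p⁻² ≤ Σ_{i ≥ 2} i⁻² ≤ 1`). [folklore] -/
theorem prod_le_exp_of_le (P : Finset ℕ) (hP : ∀ q ∈ P, q.Prime) (F : ℕ → ℝ) (hF0 : ∀ q ∈ P, 0 ≤ F q)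
    (hF : ∀ q ∈ P, F q ≤ 1 + 19 * ((q : ℝ) ^ 2)⁻¹) : ∏ q ∈ P, F q ≤ Real.exp 19 := by
  have h1 : ∏ q ∈ P, F q ≤ ∏ q ∈ P, Real.exp (19 * ((q : ℝ) ^ 2)⁻¹) :=
    Finset.prod_le_prod hF0 fun q hq => (hF q hq).trans (by linarith [Real.add_one_le_exp (19 * ((q : ℝ) ^ 2)⁻¹)])
  refine h1.trans ?_
  rw [← Real.exp_sum, Real.exp_le_exp, ← Finset.mul_sum]
  have hsub : P ⊆ Finset.Ioo 1 (P.sup id + 1) := fun q hq =>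
    Finset.mem_Ioo.mpr ⟨(hP q hq).one_lt, Nat.lt_succ_of_le (Finset.le_sup (f := id) hq)⟩
  have hsum : ∑ q ∈ P, ((q : ℝ) ^ 2)⁻¹ ≤ 1 :=
    calc ∑ q ∈ P, ((q : ℝ) ^ 2)⁻¹ ≤ ∑ q ∈ Finset.Ioo 1 (P.sup id + 1), ((q : ℝ) ^ 2)⁻¹ :=
          Finset.sum_le_sum_of_subset_of_nonneg hsub fun q _ _ => by positivity
      _ ≤ 2 / (1 + 1) := by exact_mod_cast sum_Ioo_inv_sq_le (α := ℝ) 1 (P.sup id + 1)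
      _ = 1 := by norm_num
  linarith

end Numerics

/-! ### The global sum `Σ_{n ≤ N} e(n)/n²` by peeling off one prime at a time -/

section Global

variable (e : ℕ → ℕ) (E : ℕ → ℕ → ℕ) (Ep : ℕ → ℝ)
  (hmul : ∀ p, p.Prime → ∀ i m, ¬ p ∣ m → m ≠ 0 → e (p ^ i * m) = E p i * e m)
  (hEsum : ∀ p, p.Prime → ∀ I, ∑ i ∈ range I, (E p i : ℝ) * (((p : ℝ) ^ 2)⁻¹) ^ i ≤ Ep p)

include hmul hEsum in
/-- **Peeling off the prime `p`**: writing each `n` with prime factors in `insert p P` as `n = pⁱ m`,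
`p ∤ m`, `Σ_n e(n)/n² ≤ E_p · Σ_m e(m)/m²` over the `m ≤ N` with prime factors in `P`. [folklore] -/
theorem sum_filter_insert_le {p : ℕ} (hp : p.Prime) (P : Finset ℕ) (N : ℕ) :
    ∑ n ∈ (Icc 1 N).filter (fun n => n.primeFactors ⊆ insert p P), (e n : ℝ) / (n : ℝ) ^ 2 ≤
      Ep p * ∑ m ∈ (Icc 1 N).filter (fun m => m.primeFactors ⊆ P), (e m : ℝ) / (m : ℝ) ^ 2 := by
  set x : ℝ := ((p : ℝ) ^ 2)⁻¹ with hxdef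
  set S := (Icc 1 N).filter (fun n => n.primeFactors ⊆ insert p P)
  set F := (Icc 1 N).filter (fun m => m.primeFactors ⊆ P)
  set ι : ℕ → ℕ × ℕ := fun n => (n.factorization p, n / p ^ n.factorization p) with hι
  set w : ℕ × ℕ → ℝ := fun t => ((E p t.1 : ℝ) * x ^ t.1) * ((e t.2 : ℝ) / (t.2 : ℝ) ^ 2) with hw
  have hp0 : (0 : ℝ) < p := by exact_mod_cast hp.pos
  -- the decomposition `n = pⁱ m`
  have hdec : ∀ n ∈ S, p ^ n.factorization p * (n / p ^ n.factorization p) = n ∧ 1 ≤ n ∧ n ≤ N ∧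
      ¬ p ∣ n / p ^ n.factorization p ∧ (n / p ^ n.factorization p).primeFactors ⊆ P := by
    intro n hn
    obtain ⟨hI, hsub⟩ := Finset.mem_filter.mp hn
    obtain ⟨h1, hN⟩ := Finset.mem_Icc.mp hI
    have hn0 : n ≠ 0 := by omega
    refine ⟨Nat.ordProj_mul_ordCompl_eq_self n p, h1, hN, Nat.not_dvd_ordCompl hp hn0, ?_⟩
    rw [← Nat.support_factorization, Nat.factorization_ordCompl, Finsupp.support_erase, Nat.support_factorization]
    exact (Finset.erase_subset_erase p hsub).trans (Finset.erase_insert_subset p P)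
  -- weights agree
  have hweight : ∀ n ∈ S, (e n : ℝ) / (n : ℝ) ^ 2 = w (ι n) := by
    intro n hn
    obtain ⟨hnm, h1, -, hndvd, -⟩ := hdec n hn
    have hm0 : n / p ^ n.factorization p ≠ 0 := (Nat.ordCompl_pos p (by omega)).ne'
    simp only [hw, hι]
    conv_lhs => rw [← hnm]
    rw [hmul p hp _ _ hndvd hm0]
    have hpi : (0 : ℝ) < (p : ℝ) ^ n.factorization p := by positivity
    have hm : (0 : ℝ) < ((n / p ^ n.factorization p : ℕ) : ℝ) := by exact_mod_cast Nat.pos_of_ne_zero hm0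
    rw [hxdef, inv_pow, ← pow_mul]
    push_cast
    field_simp
    ring
  -- injectivity and image
  have hinj : Set.InjOn ι S := by
    intro n₁ hn₁ n₂ hn₂ h
    simp only [hι, Prod.mk.injEq] at h
    rw [← (hdec n₁ hn₁).1, ← (hdec n₂ hn₂).1, h.2, h.1]
  have himage : S.image ι ⊆ (range (N + 1)) ×ˢ F := by
    intro t ht
    obtain ⟨n, hn, rfl⟩ := Finset.mem_image.mp ht
    obtain ⟨hnm, h1, hN, -, hsubP⟩ := hdec n hn
    have hn0 : n ≠ 0 := by omega
    refine Finset.mem_product.mpr ⟨Finset.mem_range.mpr ?_, Finset.mem_filter.mpr ⟨Finset.mem_Icc.mpr ⟨?_, ?_⟩, hsubP⟩⟩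
    · exact (Nat.factorization_lt p hn0).trans_le (by omega)
    · exact Nat.ordCompl_pos p hn0
    · exact (Nat.div_le_self _ _).trans hN
  have hw0 : ∀ t ∈ (range (N + 1)) ×ˢ F, 0 ≤ w t := fun t _ => by simp only [hw]; positivity
  have hF0 : 0 ≤ ∑ m ∈ F, (e m : ℝ) / (m : ℝ) ^ 2 := Finset.sum_nonneg fun m _ => by positivity
  calc ∑ n ∈ S, (e n : ℝ) / (n : ℝ) ^ 2 = ∑ n ∈ S, w (ι n) := Finset.sum_congr rfl hweight
    _ = ∑ t ∈ S.image ι, w t := (Finset.sum_image hinj).symm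
    _ ≤ ∑ t ∈ (range (N + 1)) ×ˢ F, w t := Finset.sum_le_sum_of_subset_of_nonneg himage fun t ht _ => hw0 t ht
    _ = (∑ i ∈ range (N + 1), (E p i : ℝ) * x ^ i) * ∑ m ∈ F, (e m : ℝ) / (m : ℝ) ^ 2 := by
        rw [Finset.sum_product, Finset.sum_mul]
        refine Finset.sum_congr rfl fun i _ => ?_
        rw [Finset.mul_sum]
    _ ≤ Ep p * ∑ m ∈ F, (e m : ℝ) / (m : ℝ) ^ 2 := mul_le_mul_of_nonneg_right (hEsum p hp (N + 1)) hF0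

include hmul hEsum in
/-- **Iterating over a finite set of primes**: `Σ_{n ≤ N, primes(n) ⊆ P} e(n)/n² ≤ ∏_{p ∈ P} E_p`
(given `e(1) = 1`). [folklore] -/
theorem sum_filter_le_prod (he1 : e 1 = 1) (hEp : ∀ p, p.Prime → 0 ≤ Ep p) (P : Finset ℕ)
    (hP : ∀ p ∈ P, p.Prime) (N : ℕ) :
    ∑ n ∈ (Icc 1 N).filter (fun n => n.primeFactors ⊆ P), (e n : ℝ) / (n : ℝ) ^ 2 ≤ ∏ p ∈ P, Ep p := by
  induction P using Finset.induction_on with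
  | empty =>
    rw [Finset.prod_empty]
    have hsub : (Icc 1 N).filter (fun n => n.primeFactors ⊆ ∅) ⊆ {1} := by
      intro n hn
      obtain ⟨hI, hsub⟩ := Finset.mem_filter.mp hn
      obtain ⟨h1, -⟩ := Finset.mem_Icc.mp hI
      have h := Nat.primeFactors_eq_empty.mp (Finset.subset_empty.mp hsub)
      exact Finset.mem_singleton.mpr (by omega)
    refine (Finset.sum_le_sum_of_subset_of_nonneg hsub fun n _ _ => by positivity).trans ?_
    simp [he1]
  | insert p P hpP ih =>
    have hp : p.Prime := hP p (Finset.mem_insert_self p P)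
    have hP' : ∀ q ∈ P, q.Prime := fun q hq => hP q (Finset.mem_insert_of_mem hq)
    rw [Finset.prod_insert hpP]
    exact (sum_filter_insert_le e E Ep hmul hEsum hp P N).trans (mul_le_mul_of_nonneg_left (ih hP') (hEp p hp))

include hmul hEsum in
/-- **`Σ_{n=1}^{N} e(n)/n² ≤ K₀`** as soon as all the Euler products over finite sets of primes are `≤ K₀`. [folklore] -/
theorem sum_Icc_le_of_prod_le (he1 : e 1 = 1) (hEp : ∀ p, p.Prime → 0 ≤ Ep p) {K₀ : ℝ}
    (hK : ∀ P : Finset ℕ, (∀ p ∈ P, p.Prime) → ∏ p ∈ P, Ep p ≤ K₀) (N : ℕ) :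
    ∑ n ∈ Icc 1 N, (e n : ℝ) / (n : ℝ) ^ 2 ≤ K₀ := by
  set P := (range (N + 1)).filter Nat.Prime with hPdef
  have hP : ∀ p ∈ P, p.Prime := fun p hp => (Finset.mem_filter.mp hp).2
  have hall : (Icc 1 N).filter (fun n => n.primeFactors ⊆ P) = Icc 1 N := by
    refine Finset.filter_true_of_mem fun n hn q hq => ?_
    obtain ⟨-, hN⟩ := Finset.mem_Icc.mp hn
    have hq' := Nat.mem_primeFactors.mp hq
    refine Finset.mem_filter.mpr ⟨Finset.mem_range.mpr ?_, hq'.1⟩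
    exact Nat.lt_succ_of_le ((Nat.le_of_dvd (by omega) hq'.2.1).trans hN)
  rw [← hall]
  exact (sum_filter_le_prod e E Ep hmul hEsum he1 hEp P hP N).trans (hK P hP)

end Global

/-! ### The packaged uniform bound -/

/-- The recursion sequences exist (defined by `Nat.rec` on triples / pairs). [folklore] -/
theorem exists_recursion_seqs :
    ∃ A E : ℕ → ℕ → ℕ, (∀ p, A p 0 = 1) ∧ (∀ p, A p 1 = 3) ∧ (∀ p, A p 2 = 9) ∧
      (∀ p i, A p (i + 3) = 3 * A p (i + 2) + (p + 1) * A p i) ∧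
      (∀ p, E p 0 = 1) ∧ (∀ p, E p 1 = 3) ∧ ∀ p i, E p (i + 2) = A p (i + 2) + E p i := by
  let T : ℕ → ℕ → ℕ × ℕ × ℕ := fun p =>
    Nat.rec (1, 3, 9) (fun _ t => (t.2.1, t.2.2, 3 * t.2.2 + (p + 1) * t.1))
  let A : ℕ → ℕ → ℕ := fun p i => (T p i).1
  have hA : ∀ p i, A p (i + 3) = 3 * A p (i + 2) + (p + 1) * A p i := fun p i => rfl
  let U : ℕ → ℕ → ℕ × ℕ := fun p => Nat.rec (1, 3) (fun i u => (u.2, A p (i + 2) + u.1))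
  let E : ℕ → ℕ → ℕ := fun p i => (U p i).1
  have hE : ∀ p i, E p (i + 2) = A p (i + 2) + E p i := fun p i => rfl
  exact ⟨A, E, fun p => rfl, fun p => rfl, fun p => rfl, hA, fun p => rfl, fun p => rfl, hE⟩

/-- **The uniform subring-count bound** (replacing Datskovsky–Wright in the published proof of BBP Lemma 3.4
= BTT Prop. 4.5): there are `e : ℕ → ℕ` and an absolute `K₀` such that every maximal nondegenerate cubic
ring `R(g)` has at most `e(n)` isomorphism classes of subrings of index `n` (orbits of `indexPOrbits g n`)
and `Σ_{n=1}^{N} e(n)/n² ≤ K₀` for all `N` (indeed `K₀ = e¹⁹`). [folklore] -/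
theorem exists_uniform_indexPOrbits_bound :
    ∃ (e : ℕ → ℕ) (K₀ : ℝ), (∀ g : BinaryCubic ℤ, IsMaximal g → g.disc ≠ 0 → ∀ n, 0 < n →
      (indexPOrbits g n).ncard ≤ e n) ∧ ∀ N, ∑ n ∈ Icc 1 N, (e n : ℝ) / (n : ℝ) ^ 2 ≤ K₀ := by
  obtain ⟨A, E, hA0, hA1, hA2, hA, hE0, hE1, hE⟩ := exists_recursion_seqs
  refine ⟨fun n => n.factorization.prod fun q j => E q j, Real.exp 19, fun g hg hg0 n hn =>
    ncard_indexPOrbits_le_factorization_prod A E hA0 hA1 hA2 hA hE0 hE1 hE hg hg0 hn, ?_⟩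
  set Ep : ℕ → ℝ := fun p => ((1 - (((p : ℝ) ^ 2)⁻¹) ^ 2) *
    (1 - (3 * ((p : ℝ) ^ 2)⁻¹ + ((p : ℝ) + 1) * (((p : ℝ) ^ 2)⁻¹) ^ 3)))⁻¹ with hEpdef
  have hEsum : ∀ p, p.Prime → ∀ I, ∑ i ∈ range I, (E p i : ℝ) * (((p : ℝ) ^ 2)⁻¹) ^ i ≤ Ep p := by
    intro p hp I
    obtain ⟨hθ, hx1, -⟩ := ebound_le p hp.two_le
    exact sum_range_ebar_le p (A p) (hA0 p) (hA1 p) (hA2 p) (hA p) (E p) (hE0 p) (hE1 p) (hE p)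
      (by positivity) hx1 hθ I
  have hEp : ∀ p, p.Prime → 0 ≤ Ep p := fun p hp => by
    simpa using hEsum p hp 0
  refine sum_Icc_le_of_prod_le _ E Ep (fun p hp i m hm hm0 => factorization_prod_pow_mul E hE0 hp hm hm0 i)
    hEsum (by simp) hEp (fun P hP => ?_)
  exact prod_le_exp_of_le P hP Ep (fun q hq => hEp q (hP q hq)) fun q hq => (ebound_le q (hP q hq).two_le).2.2

end Literature.NumberTheory.CubicFields

end
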